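import Summits.CriticalPhenomena.PercolationContinuityZ3.Theorems.PercNearOneGluingNoHeavyQuantThreeClusterSwapReduction
import HarnessLib

/-!
# The cut-off swap: a second injective two-configuration map for the three-cluster product row
# `P(abc)·P(a|b|c) ≤ 2·[P(ab|c) + P(ac|b)] + P⊗P(R₀)`

builds on p205010 (kernel theorem, internal audit signed; external expert review pending)

Support file (`--supports stmt-CriticalPhenomena-4575`), seat `prim-quant-p1` (gen 42); memo
`run/shared/lean/prim/quant/prim-quant-p1-g42/FOR-LEAD-Z32-CUTOFF.md` §1–§2.  No definitions, no named facts, no sorries;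
standard axioms.

CONTEXT.  ✓ p577001 `ThreeClusterSwap.productRow_le_add_Pr2W` (p1 g40) reduces the product row F1 of the three-port programme,
`P(a↔b↔c)·P(a|b|c) ≤ C·[P(ab|c) + P(ac|b)]` (`C = 3` closes the three-port case of `Z(3,2)` via ✓ p560550), to the
doubly-sealed-failure set `B` of pairs `(C₂, C₁)` (`C₂ ∈ a|b|c`, `C₁ ∈ abc`, both single seals fail):
`P(abc)·P(a|b|c) ≤ P(ab|c) + P(ac|b) + P⊗P(B)`.  THIS FILE gives a SECOND weight-preserving injective map on `B`, the
CUT-OFF swap, and hence the reduction with constant `2`: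

* With `S = C_b(C₂)` the `C₂`-cluster of `b` (so `c ∉ S`), `Q = ` the `C₁`-cluster of `c` AVOIDING `S` (open `C₁`-edges not
  touching `S`), and `F = E(Q, S)` the edges joining `Q` to `S`: every edge of `F` is `C₂`-closed (`cut_not_mem_of_mem_F`), so the
  swap of the pair along `F` has first output `Z = C₁ ∖ F`; the `Z`-cluster of `c` is exactly `Q` (`cut_reachable_iff`), so when
  the `b`-seal fails (`a ∉ Q`) `Z` separates `a` from `c`, and `Z ∈ ab|c` as soon as `a ↔ b` in `Z`.
* DECODING (`cut_decode_b`): `Q` is the `Z`-cluster of `c`, and `S` is the cluster of `b` in the SECOND output with the edges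
  touching `Q` removed; so `F` is recovered from the output pair and the swap is INJECTIVE on its domain
  (`Pr2W_cut_le`, through the generic reindexing lemma `Pr2W_le_of_injOn` — a swap along a region depending on BOTH
  configurations, which Gladkov's self-determined Lemma 3.1 does not cover directly).
* ASSEMBLY in the companion file `…QuantThreeClusterCutOffReduction` (`productRow_le_two_add_Pr2W`):
  `P(abc)·P(a|b|c) ≤ 2·[P(ab|c) + P(ac|b)] + P⊗P(R₀)` on every finite weighted graph, where `R₀ ⊆ B` is the set of pairs on
  which both seals AND both cut-offs fail (census and structure of `R₀` in the memo).
[cite: Gladkov2024, Lemma 3.1 (p. 5), arXiv:2408.08457] (the one-configuration self-determined swap, generalised here).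
-/

namespace Summit.CriticalPhenomena.PercolationContinuityZ3.Theorems

open Literature.Probability.Percolation Literature.Probability.Percolation.DecisionTree

variable {V : Type*}

namespace ThreeClusterSwap

/-! ### Combinatorics of the cut-off configuration (arbitrary vertex type, arbitrary edge sets) -/

section CutOff

variable (C₁ C₂ : Set (Sym2 V)) (b c : V) (S Q : Set V) (TS F : Set (Sym2 V))

/-- The `C₁`-cluster of `c` avoiding `S` does not meet `S` (when `c ∉ S`). [this work] -/
theorem cut_Q_disjoint (hTS : TS = {e | ∃ v ∈ S, v ∈ e}) (hQ : Q = {v | (openGraph (C₁ \ TS)).Reachable c v})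
    (hc : c ∉ S) {v : V} (hv : v ∈ Q) : v ∉ S :=
  avoid_disjoint C₁ c S Q TS hTS hQ hc hv

/-- Every edge of `F = E(Q, S)` touches `S`. [this work] -/
theorem cut_F_sub_TS (hTS : TS = {e | ∃ v ∈ S, v ∈ e}) (hF : F = {e | ∃ q ∈ Q, ∃ s ∈ S, e = s(q, s)})
    {e : Sym2 V} (he : e ∈ F) : e ∈ TS := by
  rw [hF] at he
  obtain ⟨q, -, s, hs, rfl⟩ := he
  rw [hTS]
  exact ⟨s, hs, Sym2.mem_mk_right q s⟩

/-- Every edge of `F = E(Q, S)` touches `Q`. [this work] -/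
theorem cut_F_sub_TQ (hF : F = {e | ∃ q ∈ Q, ∃ s ∈ S, e = s(q, s)})
    {e : Sym2 V} (he : e ∈ F) : e ∈ {e | ∃ v ∈ Q, v ∈ e} := by
  rw [hF] at he
  obtain ⟨q, hq, s, -, rfl⟩ := he
  exact ⟨q, hq, Sym2.mem_mk_left q s⟩

/-- **The cut edges are `C₂`-closed.**  With `S = C_b(C₂)`, `c ∉ S`, `Q` the `C₁`-cluster of `c` avoiding `S` and
`F = E(Q, S)`: no edge of `F` is `C₂`-open (an open edge from `S` leads into `S`, but `Q ∩ S = ∅`). [this work] -/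
theorem cut_not_mem_of_mem_F (hS : S = {v | (openGraph C₂).Reachable b v}) (hTS : TS = {e | ∃ v ∈ S, v ∈ e})
    (hQ : Q = {v | (openGraph (C₁ \ TS)).Reachable c v}) (hF : F = {e | ∃ q ∈ Q, ∃ s ∈ S, e = s(q, s)})
    (hc : c ∉ S) {e : Sym2 V} (he : e ∈ F) : e ∉ C₂ := by
  intro he2
  rw [hF] at he
  obtain ⟨q, hq, s, hs, rfl⟩ := he
  have hqS : q ∉ S := cut_Q_disjoint C₁ c S Q TS hTS hQ hc hq
  have hne : s ≠ q := fun h => hqS (h ▸ hs)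
  have hadj : (openGraph C₂).Adj s q := (openGraph_adj C₂ s q).2 ⟨by rw [Sym2.eq_swap]; exact he2, hne⟩
  apply hqS
  rw [hS] at hs ⊢
  exact hs.trans hadj.reachable

/-- **The cut-off configuration seals `Q`.**  With `S, Q, F` as in `cut_not_mem_of_mem_F` (`c ∉ S`): in `Z = C₁ ∖ F` the
cluster of `c` is exactly `Q`, the `C₁`-cluster of `c` avoiding `S` (an open path of `Z` out of `Q` would have to enter `S`
through an edge of `F`). [this work] -/
theorem cut_reachable_iff (hTS : TS = {e | ∃ v ∈ S, v ∈ e})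
    (hQ : Q = {v | (openGraph (C₁ \ TS)).Reachable c v}) (hF : F = {e | ∃ q ∈ Q, ∃ s ∈ S, e = s(q, s)})
    (hc : c ∉ S) (v : V) :
    (openGraph (C₁ \ F)).Reachable c v ↔ (openGraph (C₁ \ TS)).Reachable c v := by
  have hcQ : c ∈ Q := by rw [hQ]; exact SimpleGraph.Reachable.refl c
  constructor
  · intro h
    have := reachable_transfer (G' := openGraph (C₁ \ TS)) (P := fun u => u ∈ Q) h hcQ (by
      intro u w hu huw
      rw [openGraph_adj] at huw
      obtain ⟨⟨h1, hnF⟩, hne⟩ := huw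
      have huS : u ∉ S := cut_Q_disjoint C₁ c S Q TS hTS hQ hc hu
      -- the edge does not touch `S`: else `w ∈ S` and the edge lies in `F`
      have hnt : s(u, w) ∉ TS := by
        rw [hTS]
        rintro ⟨z, hzS, hz⟩
        rcases Sym2.mem_iff.1 hz with rfl | rfl
        · exact huS hzS
        · exact hnF (by rw [hF]; exact ⟨u, hu, z, hzS, rfl⟩)
      have hadj : (openGraph (C₁ \ TS)).Adj u w := (openGraph_adj _ u w).2 ⟨⟨h1, hnt⟩, hne⟩
      refine ⟨?_, hadj⟩
      rw [hQ] at hu ⊢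
      exact hu.trans hadj.reachable)
    exact this.1
  · intro h
    have := reachable_transfer (G' := openGraph (C₁ \ F)) (P := fun _ => True) h trivial (by
      intro u w _ huw
      rw [openGraph_adj] at huw
      obtain ⟨⟨h1, hnt⟩, hne⟩ := huw
      refine ⟨trivial, (openGraph_adj _ u w).2 ⟨⟨h1, fun hf => hnt ?_⟩, hne⟩⟩
      exact cut_F_sub_TS S Q TS F hTS hF hf)
    exact this.1

/-- **Decoding the `b`-cluster from the second output.**  With `S, Q, F` as above (`c ∉ S`) and `TQ` the edges touching `Q`:
the cluster of `b` in `(C₁ ∩ F) ∪ (C₂ ∖ F)` with the edges of `TQ` removed is exactly `S = C_b(C₂)` (the edges inside `S` touch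
neither `Q` nor `F`). [this work] -/
theorem cut_decode_b (hS : S = {v | (openGraph C₂).Reachable b v}) (hTS : TS = {e | ∃ v ∈ S, v ∈ e})
    (hQ : Q = {v | (openGraph (C₁ \ TS)).Reachable c v}) (hF : F = {e | ∃ q ∈ Q, ∃ s ∈ S, e = s(q, s)})
    (hc : c ∉ S) (v : V) :
    (openGraph (((C₁ ∩ F) ∪ (C₂ \ F)) \ {e | ∃ u ∈ Q, u ∈ e})).Reachable b v ↔ (openGraph C₂).Reachable b v := by
  have hbS : b ∈ S := by rw [hS]; exact SimpleGraph.Reachable.refl b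
  constructor
  · intro h
    refine (reachable_transfer (G' := openGraph C₂) (P := fun _ => True) h trivial ?_).1
    intro u w _ huw
    rw [openGraph_adj] at huw
    obtain ⟨⟨huw, hnTQ⟩, hne⟩ := huw
    refine ⟨trivial, (openGraph_adj _ u w).2 ⟨?_, hne⟩⟩
    rcases huw with ⟨-, hf⟩ | ⟨h2, -⟩
    · exact (hnTQ (cut_F_sub_TQ S Q F hF hf)).elim
    · exact h2
  · intro h
    have := reachable_transfer (G' := openGraph (((C₁ ∩ F) ∪ (C₂ \ F)) \ {e | ∃ u ∈ Q, u ∈ e}))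
      (P := fun u => u ∈ S) h hbS (by
      intro u w hu huw
      rw [openGraph_adj] at huw
      obtain ⟨h2, hne⟩ := huw
      have hwS : w ∈ S := by
        rw [hS] at hu ⊢
        exact hu.trans ((openGraph_adj C₂ u w).2 ⟨h2, hne⟩).reachable
      have hnF : s(u, w) ∉ F := fun hf => cut_not_mem_of_mem_F C₁ C₂ b c S Q TS F hS hTS hQ hF hc hf h2
      have hnTQ : s(u, w) ∉ {e | ∃ u ∈ Q, u ∈ e} := by
        rintro ⟨z, hzQ, hz⟩
        have hzS : z ∉ S := cut_Q_disjoint C₁ c S Q TS hTS hQ hc hzQ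
        rcases Sym2.mem_iff.1 hz with rfl | rfl
        · exact hzS hu
        · exact hzS hwS
      exact ⟨hwS, (openGraph_adj _ u w).2 ⟨⟨Or.inr ⟨h2, hnF⟩, hnTQ⟩, hne⟩⟩)
    exact this.1

/-- The first output of the swap along `F` is the cut-off configuration: `(C₂ ∩ F) ∪ (C₁ ∖ F) = C₁ ∖ F`
(the edges of `F` are `C₂`-closed). [this work] -/
theorem cut_first_output (hS : S = {v | (openGraph C₂).Reachable b v}) (hTS : TS = {e | ∃ v ∈ S, v ∈ e})
    (hQ : Q = {v | (openGraph (C₁ \ TS)).Reachable c v}) (hF : F = {e | ∃ q ∈ Q, ∃ s ∈ S, e = s(q, s)})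
    (hc : c ∉ S) : (C₂ ∩ F) ∪ (C₁ \ F) = C₁ \ F := by
  ext e
  constructor
  · rintro (⟨h2, hf⟩ | h)
    · exact (cut_not_mem_of_mem_F C₁ C₂ b c S Q TS F hS hTS hQ hF hc hf h2).elim
    · exact h
  · exact fun h => Or.inr h

end CutOff

/-! ### Reindexing by an injective weight-preserving pair map -/

section Reindex

open scoped Classical

variable {ι : Type*} [DecidableEq ι]

/-- **Reindexing by an injective weight-preserving map of the pair space** (the form of Gladkov's Lemma 3.1 needed for a
swap region that depends on BOTH configurations): if `Φ` maps the `D`-pairs of `A` injectively and weight-preservingly into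
`B`, then `Pr2W(A) ≤ Pr2W(B)`. [cite: Gladkov2024, Lemma 3.1 (p. 5), arXiv:2408.08457] (generalised) -/
theorem Pr2W_le_of_injOn (D : Finset ι) {p : ι → ℝ} (hp0 : ∀ i, 0 ≤ p i) (hp1 : ∀ i, p i ≤ 1)
    (A B : Set (Finset ι × Finset ι)) (Φ : Finset ι × Finset ι → Finset ι × Finset ι)
    (hmem : ∀ x ∈ D.powerset ×ˢ D.powerset, x ∈ A → Φ x ∈ D.powerset ×ˢ D.powerset)
    (hwt : ∀ x ∈ D.powerset ×ˢ D.powerset, x ∈ A → wt2W D p (Φ x) = wt2W D p x)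
    (hinj : ∀ x ∈ D.powerset ×ˢ D.powerset, ∀ y ∈ D.powerset ×ˢ D.powerset, x ∈ A → y ∈ A → Φ x = Φ y → x = y)
    (hAB : ∀ x ∈ D.powerset ×ˢ D.powerset, x ∈ A → Φ x ∈ B) :
    Pr2W D p A ≤ Pr2W D p B := by
  unfold Pr2W
  set P := D.powerset ×ˢ D.powerset with hP
  have e1 : ∑ x ∈ P, A.indicator (wt2W D p) x = ∑ x ∈ P.filter (· ∈ A), wt2W D p x := by
    rw [Finset.sum_filter]
    refine Finset.sum_congr rfl fun x _ => ?_
    by_cases hx : x ∈ A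
    · rw [Set.indicator_of_mem hx, if_pos hx]
    · rw [Set.indicator_of_notMem hx, if_neg hx]
  have e2 : ∑ x ∈ P.filter (· ∈ A), wt2W D p x = ∑ x ∈ P.filter (· ∈ A), wt2W D p (Φ x) := by
    refine Finset.sum_congr rfl fun x hx => ?_
    rw [Finset.mem_filter] at hx
    rw [hwt x hx.1 hx.2]
  have e3 : ∑ x ∈ P.filter (· ∈ A), wt2W D p (Φ x) = ∑ y ∈ (P.filter (· ∈ A)).image Φ, wt2W D p y := by
    rw [Finset.sum_image]
    intro x hx y hy hxy
    rw [Finset.coe_filter] at hx hy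
    exact hinj x hx.1 y hy.1 hx.2 hy.2 hxy
  have hsub : (P.filter (· ∈ A)).image Φ ⊆ P.filter (· ∈ B) := by
    intro y hy
    rw [Finset.mem_image] at hy
    obtain ⟨x, hx, rfl⟩ := hy
    rw [Finset.mem_filter] at hx ⊢
    exact ⟨hmem x hx.1 hx.2, hAB x hx.1 hx.2⟩
  have e4 : ∑ y ∈ P.filter (· ∈ B), wt2W D p y = ∑ x ∈ P, B.indicator (wt2W D p) x := by
    rw [Finset.sum_filter]
    refine Finset.sum_congr rfl fun x _ => ?_
    by_cases hx : x ∈ B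
    · rw [Set.indicator_of_mem hx, if_pos hx]
    · rw [Set.indicator_of_notMem hx, if_neg hx]
  rw [e1, e2, e3, ← e4]
  exact Finset.sum_le_sum_of_subset_of_nonneg hsub fun y _ _ => wt2W_nonneg D hp0 hp1 y

end Reindex

/-! ### The cut-off swap bounds its success set by the target cell `ab|c` -/

section Finitary

open scoped Classical

variable [Fintype V] [DecidableEq V]

/-- **The cut-off swap (towards `c`) is a weight-preserving injection into `ab|c`.**  For pairs `(C₂, C₁)` of configurations
of the finite edge type with: `c ∉ S := C_b(C₂)`; the `b`-seal failing (`a` is not joined to `c` by `C₁`-edges avoiding `S`);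
and `a ↔ b` in the cut-off configuration `Z = C₁ ∖ E(Q, S)` (`Q` = the `C₁`-cluster of `c` avoiding `S`) — the pair probability
is at most `PrW{a ↔ b ∧ a ↮ c}`.  Swap along `E(Q, S)`; the first output is `Z ∈ ab|c` (`cut_first_output`, `cut_reachable_iff`),
and the region is decoded from the output pair (`cut_reachable_iff`, `cut_decode_b`), so `Pr2W_le_of_injOn` applies. [this work] -/
theorem Pr2W_cut_le (p : Sym2 V → ℝ) (hp0 : ∀ e, 0 ≤ p e) (hp1 : ∀ e, p e ≤ 1) (a b c : V) :
    Pr2W Finset.univ p {x : Finset (Sym2 V) × Finset (Sym2 V) |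
        ¬ (openGraph (↑x.1 : Set (Sym2 V))).Reachable b c ∧
        ¬ (openGraph ((↑x.2 : Set (Sym2 V)) \
            {e | ∃ v ∈ {v | (openGraph (↑x.1 : Set (Sym2 V))).Reachable b v}, v ∈ e})).Reachable a c ∧
        (openGraph ((↑x.2 : Set (Sym2 V)) \
            {e | ∃ q ∈ {q | (openGraph ((↑x.2 : Set (Sym2 V)) \
                  {e | ∃ v ∈ {v | (openGraph (↑x.1 : Set (Sym2 V))).Reachable b v}, v ∈ e})).Reachable c q},
                 ∃ s ∈ {v | (openGraph (↑x.1 : Set (Sym2 V))).Reachable b v}, e = s(q, s)})).Reachable a b} ≤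
      PrW Finset.univ p {S : Finset (Sym2 V) | (openGraph (↑S : Set (Sym2 V))).Reachable a b ∧
        ¬ (openGraph (↑S : Set (Sym2 V))).Reachable a c} := by
  set D : Finset (Sym2 V) := Finset.univ with hD
  -- the region and the map, as functions of the pair
  let Sset : Finset (Sym2 V) × Finset (Sym2 V) → Set V := fun x => {v | (openGraph (↑x.1 : Set (Sym2 V))).Reachable b v}
  let TS : Finset (Sym2 V) × Finset (Sym2 V) → Set (Sym2 V) := fun x => {e | ∃ v ∈ Sset x, v ∈ e}
  let Qset : Finset (Sym2 V) × Finset (Sym2 V) → Set V := fun x =>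
    {q | (openGraph ((↑x.2 : Set (Sym2 V)) \ TS x)).Reachable c q}
  let Fset : Finset (Sym2 V) × Finset (Sym2 V) → Set (Sym2 V) := fun x => {e | ∃ q ∈ Qset x, ∃ s ∈ Sset x, e = s(q, s)}
  let Fm : Finset (Sym2 V) × Finset (Sym2 V) → Finset (Sym2 V) := fun x => Finset.univ.filter fun e => e ∈ Fset x
  let Φ : Finset (Sym2 V) × Finset (Sym2 V) → Finset (Sym2 V) × Finset (Sym2 V) := fun x =>
    (splice (Fm x) x.1 x.2, splice (Fm x) x.2 x.1)
  -- the decoder: the same region read off the OUTPUT pair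
  let Qdec : Finset (Sym2 V) × Finset (Sym2 V) → Set V := fun y => {q | (openGraph (↑y.1 : Set (Sym2 V))).Reachable c q}
  let Sdec : Finset (Sym2 V) × Finset (Sym2 V) → Set V := fun y =>
    {s | (openGraph ((↑y.2 : Set (Sym2 V)) \ {e | ∃ u ∈ Qdec y, u ∈ e})).Reachable b s}
  let Fdec : Finset (Sym2 V) × Finset (Sym2 V) → Set (Sym2 V) := fun y => {e | ∃ q ∈ Qdec y, ∃ s ∈ Sdec y, e = s(q, s)}
  let abEv : Set (Finset (Sym2 V)) := {S | (openGraph (↑S : Set (Sym2 V))).Reachable a b ∧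
    ¬ (openGraph (↑S : Set (Sym2 V))).Reachable a c}
  let A : Set (Finset (Sym2 V) × Finset (Sym2 V)) := {x | ¬ (openGraph (↑x.1 : Set (Sym2 V))).Reachable b c ∧
    ¬ (openGraph ((↑x.2 : Set (Sym2 V)) \ TS x)).Reachable a c ∧ (openGraph ((↑x.2 : Set (Sym2 V)) \ Fset x)).Reachable a b}
  change Pr2W D p A ≤ PrW D p abEv
  have hcoeF : ∀ x, (↑(Fm x) : Set (Sym2 V)) = Fset x := by
    intro x; ext e; simp [Fm]
  -- basic facts on the domain
  have hcS : ∀ x ∈ A, c ∉ Sset x := fun x hx hc => hx.1 hc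
  have hfirst : ∀ x ∈ A, (↑(Φ x).1 : Set (Sym2 V)) = (↑x.2 : Set (Sym2 V)) \ Fset x := by
    intro x hx
    change (↑(splice (Fm x) x.1 x.2) : Set (Sym2 V)) = _
    rw [coe_splice, hcoeF]
    exact cut_first_output (↑x.2) (↑x.1) b c (Sset x) (Qset x) (TS x) (Fset x) rfl rfl rfl rfl (hcS x hx)
  have hsecond : ∀ x, (↑(Φ x).2 : Set (Sym2 V)) = ((↑x.2 : Set (Sym2 V)) ∩ Fset x) ∪ ((↑x.1 : Set (Sym2 V)) \ Fset x) := by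
    intro x
    change (↑(splice (Fm x) x.2 x.1) : Set (Sym2 V)) = _
    rw [coe_splice, hcoeF]
  -- decoding: the region of `x ∈ A` is read off `Φ x`
  have hQdec : ∀ x ∈ A, Qdec (Φ x) = Qset x := by
    intro x hx
    ext q
    change (openGraph (↑(Φ x).1 : Set (Sym2 V))).Reachable c q ↔ (openGraph ((↑x.2 : Set (Sym2 V)) \ TS x)).Reachable c q
    rw [hfirst x hx]
    exact cut_reachable_iff (↑x.2) c (Sset x) (Qset x) (TS x) (Fset x) rfl rfl rfl (hcS x hx) q
  have hSdec : ∀ x ∈ A, Sdec (Φ x) = Sset x := by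
    intro x hx
    ext s
    change (openGraph ((↑(Φ x).2 : Set (Sym2 V)) \ {e | ∃ u ∈ Qdec (Φ x), u ∈ e})).Reachable b s ↔
      (openGraph (↑x.1 : Set (Sym2 V))).Reachable b s
    rw [hsecond x, hQdec x hx]
    exact cut_decode_b (↑x.2) (↑x.1) b c (Sset x) (Qset x) (TS x) (Fset x) rfl rfl rfl rfl (hcS x hx) s
  have hFdec : ∀ x ∈ A, Fdec (Φ x) = Fset x := by
    intro x hx
    ext e
    change (∃ q ∈ Qdec (Φ x), ∃ s ∈ Sdec (Φ x), e = s(q, s)) ↔ (∃ q ∈ Qset x, ∃ s ∈ Sset x, e = s(q, s))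
    rw [hQdec x hx, hSdec x hx]
  have hFm : ∀ x ∈ A, Fm x = Finset.univ.filter fun e => e ∈ Fdec (Φ x) := by
    intro x hx
    ext e
    simp only [Fm, Finset.mem_filter, Finset.mem_univ, true_and, hFdec x hx]
  have hPuniv : ∀ y : Finset (Sym2 V) × Finset (Sym2 V), y ∈ D.powerset ×ˢ D.powerset := by
    intro y
    rw [Finset.mem_product, Finset.mem_powerset, Finset.mem_powerset]
    exact ⟨Finset.subset_univ _, Finset.subset_univ _⟩
  have hrhs : PrW D p abEv = Pr2W D p (abEv ×ˢ (Set.univ : Set (Finset (Sym2 V)))) := by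
    rw [Pr2W_prod, PrW_univ, mul_one]
  rw [hrhs]
  refine Pr2W_le_of_injOn D hp0 hp1 A _ Φ (fun x _ _ => hPuniv _) (fun x _ _ => ?_) (fun x _ y _ hx hy hxy => ?_)
    (fun x _ hx => ?_)
  · -- weight preservation of a swap along any region
    change wtW D p (splice (Fm x) x.1 x.2) * wtW D p (splice (Fm x) x.2 x.1) = wtW D p x.1 * wtW D p x.2
    exact wtW_splice_mul_wtW_splice D p (Fm x) x.1 x.2
  · -- injectivity by decoding
    have hF : Fm x = Fm y := by rw [hFm x hx, hFm y hy, hxy]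
    have ex : x = (splice (Fm x) (Φ x).1 (Φ x).2, splice (Fm x) (Φ x).2 (Φ x).1) := by
      change x = (splice (Fm x) (splice (Fm x) x.1 x.2) (splice (Fm x) x.2 x.1),
        splice (Fm x) (splice (Fm x) x.2 x.1) (splice (Fm x) x.1 x.2))
      rw [splice_splice_left, splice_splice_left]
    have ey : y = (splice (Fm y) (Φ y).1 (Φ y).2, splice (Fm y) (Φ y).2 (Φ y).1) := by
      change y = (splice (Fm y) (splice (Fm y) y.1 y.2) (splice (Fm y) y.2 y.1),
        splice (Fm y) (splice (Fm y) y.2 y.1) (splice (Fm y) y.1 y.2))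
      rw [splice_splice_left, splice_splice_left]
    rw [ex, ey, hF, hxy]
  · -- the first output lies in `ab|c`
    refine Set.mk_mem_prod ?_ (Set.mem_univ _)
    change (openGraph (↑(Φ x).1 : Set (Sym2 V))).Reachable a b ∧ ¬ (openGraph (↑(Φ x).1 : Set (Sym2 V))).Reachable a c
    rw [hfirst x hx]
    refine ⟨hx.2.2, fun h => hx.2.1 ?_⟩
    exact ((cut_reachable_iff (↑x.2) c (Sset x) (Qset x) (TS x) (Fset x) rfl rfl rfl (hcS x hx) a).1 h.symm).symm

end Finitary

end ThreeClusterSwap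

end Summit.CriticalPhenomena.PercolationContinuityZ3.Theorems
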